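import Literature.ModelTheory.Zilber.EACDensityLineTwist
import Mathlib.Analysis.Normed.Module.Connected
import Mathlib.LinearAlgebra.Complex.FiniteDimensional
import Mathlib.FieldTheory.IsAlgClosed.Basic
import HarnessLib

/-!
# Totally real hyperplane × graph curve (1/3): zeros of weighted log-moduli of polynomials

Zilber's Exponential-Algebraic Closedness, case ladder (host summit Schanuel, cell `pub-schanuel`,
seat 2, gen 7).  First of three files on the `(s+1)`-folds
`W = {x_{s+1} = Σⱼ rⱼ xⱼ + c, yⱼ = qⱼ(y_{s+1}) (j ≤ s)} ⊆ ℂ^{s+1} × ℂ^{s+1}` with REAL `rⱼ` — the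
product of a totally real affine hyperplane with the graph curve `u ↦ (q₁(u), …, q_s(u), u)`; see
`ZilberEacRealSplit` for the theorem (existence of exponential points; for `s = 2` members of the
first open cell `EC(3,2)` at the purely oscillatory end `λ = 0` not reached by
`ZilberEacComplexRealHyperplane`).

**HONEST FRAMING.** Existence of exponential points on such split varieties is IN PRINT
(Gallinaro, Selecta Math. 29 (2023) Thm 8.8, `L × W` with `L` linear); new are the unconditional
kernel proof and the method.  Nothing here bears on Schanuel's conjecture (EAC ⇏ SC); `ECCell 3 2`
stays OPEN.

This file — a self-contained lemma of one complex variable (`exists_zero_weightedLogNorm`): for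
nonzero polynomials `p_i ∈ ℂ[u]` and real weights `w_i` with `Σ_i w_i deg p_i ≠ 0`, the function
`φ(u) = Σ_i w_i log |p_i(u)| + C` has a zero off the roots of the `p_i`.  Proof: `φ` is continuous on
`Ω = ℂ \\ {roots}` (connected — complement of a finite set, Mathlib
`Set.Countable.isPathConnected_compl_of_one_lt_rank`); near a root `ρ` of total "charge"
`e_ρ = Σ_i w_i mult_ρ(p_i)` one has `φ = e_ρ log |u - ρ| + O(1)`, at infinity
`φ = (Σ_i w_i deg p_i) log |u| + O(1)`, and the charges sum to `Σ_i w_i deg p_i ≠ 0`; so `φ` takes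
both signs on `Ω`, and the intermediate value theorem on `Ω` gives the zero.  The level set of
`ZilberEacRealSplit` is the case `p = (u, q₁, …, q_s)`, `w = (1, -r₁, …, -r_s)`.
-/

noncomputable section

open MvPolynomial Filter Topology Complex Metric
open Literature.NumberTheory.Transcendental Literature.ModelTheory.Zilber
  Literature.ModelTheory.ExponentialFields

set_option linter.dupNamespace false

namespace Summit.Schanuel.Schanuel.Theorems

section WeightedLogNorm

variable {ι : Type*} [Fintype ι]

/-- `φ(u) = Σ_i w_i log |p_i(u)| + C` is continuous off the roots of the `p_i`. -/
theorem continuousAt_weightedLogNorm (w : ι → ℝ) (C : ℝ) (p : ι → Polynomial ℂ) {u : ℂ}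
    (hu : ∀ i, (p i).eval u ≠ 0) :
    ContinuousAt (fun v : ℂ => ∑ i, w i * Real.log ‖(p i).eval v‖ + C) u := by
  refine ContinuousAt.add ?_ continuousAt_const
  refine tendsto_finsetSum _ fun i _ => continuousAt_const.mul ?_
  exact ((p i).continuous.continuousAt.norm).log (norm_ne_zero_iff.2 (hu i))

/-- **Asymptotics at infinity**: `φ(t) - (Σ_i w_i deg p_i) log t` has a finite limit as the real
`t → +∞` (`p_i(t) = t^{D_i} Q_i(1/t)` with `Q_i(0) = lc(p_i) ≠ 0`). -/
theorem tendsto_weightedLogNorm_sub_atTop (w : ι → ℝ) (C : ℝ) {p : ι → Polynomial ℂ}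
    (hp : ∀ i, p i ≠ 0) :
    ∃ G₀ : ℝ, Tendsto (fun t : ℝ => (∑ i, w i * Real.log ‖(p i).eval (t : ℂ)‖ + C) -
        (∑ i, w i * (p i).natDegree) * Real.log t) atTop (𝓝 G₀) := by
  -- the reversed polynomials as functions of `v = 1/t`
  set Q : ι → ℂ → ℂ := fun i v =>
    ∑ k ∈ Finset.range ((p i).natDegree + 1), (p i).coeff k * v ^ ((p i).natDegree - k) with hQ
  have hQcont : ∀ i, Continuous (Q i) := fun i =>
    continuous_finsetSum _ fun k _ => continuous_const.mul (continuous_pow _)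
  have hQ0 : ∀ i, Q i 0 = (p i).leadingCoeff := by
    intro i
    simp only [hQ]
    rw [Finset.sum_eq_single (p i).natDegree]
    · rw [Nat.sub_self, pow_zero, mul_one, Polynomial.leadingCoeff]
    · intro k hk hne
      have hlt : k < (p i).natDegree :=
        lt_of_le_of_ne (Nat.lt_succ_iff.1 (Finset.mem_range.1 hk)) hne
      rw [zero_pow (Nat.sub_ne_zero_of_lt hlt), mul_zero]
    · intro h
      exact absurd (Finset.mem_range.2 (Nat.lt_succ_self _)) h
  have hQeval : ∀ i (t : ℝ), t ≠ 0 →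
      (p i).eval (t : ℂ) = (t : ℂ) ^ (p i).natDegree * Q i ((t : ℂ)⁻¹) := by
    intro i t ht
    have ht' : (t : ℂ) ≠ 0 := by exact_mod_cast ht
    simp only [hQ]
    rw [Polynomial.eval_eq_sum_range, Finset.mul_sum]
    refine Finset.sum_congr rfl fun k hk => ?_
    have hk' : k ≤ (p i).natDegree := Nat.lt_succ_iff.1 (Finset.mem_range.1 hk)
    have hpow : (t : ℂ) ^ (p i).natDegree * ((t : ℂ)⁻¹) ^ ((p i).natDegree - k) =
        (t : ℂ) ^ k := by
      rw [inv_pow, ← pow_sub₀ _ ht' (Nat.sub_le _ _), Nat.sub_sub_self hk']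
    calc (p i).coeff k * (t : ℂ) ^ k = (p i).coeff k * ((t : ℂ) ^ (p i).natDegree *
          ((t : ℂ)⁻¹) ^ ((p i).natDegree - k)) := by rw [hpow]
      _ = _ := by ring
  have hinv : Tendsto (fun t : ℝ => ((t : ℂ)⁻¹)) atTop (𝓝 0) := by
    have : Tendsto (fun t : ℝ => ((t⁻¹ : ℝ) : ℂ)) atTop (𝓝 ((0 : ℝ) : ℂ)) :=
      (continuous_ofReal.tendsto 0).comp tendsto_inv_atTop_zero
    simpa using this
  have hQlim : ∀ i, Tendsto (fun t : ℝ => Q i ((t : ℂ)⁻¹)) atTop (𝓝 (p i).leadingCoeff) := by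
    intro i
    rw [← hQ0 i]
    exact ((hQcont i).tendsto 0).comp hinv
  have hlim : ∀ i, Tendsto (fun t : ℝ => Real.log ‖Q i ((t : ℂ)⁻¹)‖) atTop
      (𝓝 (Real.log ‖(p i).leadingCoeff‖)) := fun i =>
    ((hQlim i).norm).log (norm_ne_zero_iff.2 (Polynomial.leadingCoeff_ne_zero.2 (hp i)))
  refine ⟨∑ i, w i * Real.log ‖(p i).leadingCoeff‖ + C, ?_⟩
  have hsum : Tendsto (fun t : ℝ => ∑ i, w i * Real.log ‖Q i ((t : ℂ)⁻¹)‖ + C) atTop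
      (𝓝 (∑ i, w i * Real.log ‖(p i).leadingCoeff‖ + C)) :=
    (tendsto_finsetSum _ fun i _ => (hlim i).const_mul (w i)).add_const _
  refine hsum.congr' ?_
  have hev : ∀ i, ∀ᶠ t : ℝ in atTop, Q i ((t : ℂ)⁻¹) ≠ 0 := fun i =>
    (hQlim i).eventually_ne (Polynomial.leadingCoeff_ne_zero.2 (hp i))
  filter_upwards [eventually_all.2 hev, eventually_gt_atTop (0 : ℝ)] with t hQt ht
  have ht0 : t ≠ 0 := ht.ne'
  have hlogq : ∀ i, Real.log ‖(p i).eval (t : ℂ)‖ =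
      (p i).natDegree * Real.log t + Real.log ‖Q i ((t : ℂ)⁻¹)‖ := by
    intro i
    rw [hQeval i t ht0, norm_mul, norm_pow, norm_real, Real.norm_eq_abs, abs_of_pos ht,
      Real.log_mul (pow_ne_zero _ ht0) (norm_ne_zero_iff.2 (hQt i)), Real.log_pow]
  simp only [hlogq, mul_add, Finset.sum_add_distrib]
  have h1 : ∑ i, w i * ((p i).natDegree * Real.log t) = (∑ i, w i * (p i).natDegree) * Real.log t := by
    rw [Finset.sum_mul]
    exact Finset.sum_congr rfl fun i _ => by ring
  rw [h1]
  ring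

/-- **Asymptotics at a point**: for `ρ ∈ ℂ` with charge `e_ρ = Σ_i w_i mult_ρ(p_i)`,
`φ(ρ + t) - e_ρ log t` has a finite limit as the real `t → 0⁺`
(`p_i = (u - ρ)^{μ_i} g_i` with `g_i(ρ) ≠ 0`). -/
theorem tendsto_weightedLogNorm_sub_charge (w : ι → ℝ) (C : ℝ) {p : ι → Polynomial ℂ}
    (hp : ∀ i, p i ≠ 0) (ρ : ℂ) :
    ∃ G₀ : ℝ, Tendsto (fun t : ℝ => (∑ i, w i * Real.log ‖(p i).eval (ρ + t)‖ + C) -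
        (∑ i, w i * (p i).rootMultiplicity ρ) * Real.log t) (𝓝[>] 0) (𝓝 G₀) := by
  have hfac : ∀ i, ∃ g : Polynomial ℂ,
      p i = (Polynomial.X - Polynomial.C ρ) ^ (p i).rootMultiplicity ρ * g ∧ g.eval ρ ≠ 0 := by
    intro i
    obtain ⟨g, hg, hndvd⟩ :=
      Polynomial.exists_eq_pow_rootMultiplicity_mul_and_not_dvd (p i) (hp i) ρ
    exact ⟨g, hg, fun h0 => hndvd (Polynomial.dvd_iff_isRoot.2 h0)⟩
  choose g hg hgρ using hfac
  have hc : Continuous fun t : ℝ => ρ + (t : ℂ) := continuous_const.add continuous_ofReal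
  have hgcont : ∀ i, ContinuousAt (fun t : ℝ => (g i).eval (ρ + t)) 0 := fun i =>
    ((g i).continuous.comp hc).continuousAt
  have hglim : ∀ i, Tendsto (fun t : ℝ => Real.log ‖(g i).eval (ρ + t)‖) (𝓝[>] 0)
      (𝓝 (Real.log ‖(g i).eval ρ‖)) := by
    intro i
    have h1 : ContinuousAt (fun t : ℝ => Real.log ‖(g i).eval (ρ + t)‖) 0 :=
      ((hgcont i).norm).log (by simpa using norm_ne_zero_iff.2 (hgρ i))
    have h2 := h1.tendsto
    simp only [ofReal_zero, add_zero] at h2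
    exact h2.mono_left nhdsWithin_le_nhds
  refine ⟨∑ i, w i * Real.log ‖(g i).eval ρ‖ + C, ?_⟩
  have hsum : Tendsto (fun t : ℝ => ∑ i, w i * Real.log ‖(g i).eval (ρ + t)‖ + C) (𝓝[>] 0)
      (𝓝 (∑ i, w i * Real.log ‖(g i).eval ρ‖ + C)) :=
    (tendsto_finsetSum _ fun i _ => (hglim i).const_mul (w i)).add_const _
  refine hsum.congr' ?_
  have hev : ∀ i, ∀ᶠ t : ℝ in 𝓝[>] 0, (g i).eval (ρ + t) ≠ 0 := by
    intro i
    have h1 : Tendsto (fun t : ℝ => (g i).eval (ρ + t)) (𝓝[>] 0) (𝓝 ((g i).eval ρ)) := by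
      have h2 := (hgcont i).tendsto
      simp only [ofReal_zero, add_zero] at h2
      exact h2.mono_left nhdsWithin_le_nhds
    exact h1.eventually_ne (hgρ i)
  filter_upwards [eventually_all.2 hev, self_mem_nhdsWithin] with t hgt (ht : 0 < t)
  have hlog : ∀ i, Real.log ‖(p i).eval (ρ + t)‖ =
      (p i).rootMultiplicity ρ * Real.log t + Real.log ‖(g i).eval (ρ + t)‖ := by
    intro i
    have h1 : (p i).eval (ρ + t) = (t : ℂ) ^ (p i).rootMultiplicity ρ * (g i).eval (ρ + t) := by
      conv_lhs => rw [hg i]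
      simp [Polynomial.eval_mul, Polynomial.eval_pow]
    rw [h1, norm_mul, norm_pow, norm_real, Real.norm_eq_abs, abs_of_pos ht,
      Real.log_mul (pow_ne_zero _ ht.ne') (norm_ne_zero_iff.2 (hgt i)), Real.log_pow]
  simp only [hlog, mul_add, Finset.sum_add_distrib]
  have h1 : ∑ i, w i * ((p i).rootMultiplicity ρ * Real.log t) =
      (∑ i, w i * (p i).rootMultiplicity ρ) * Real.log t := by
    rw [Finset.sum_mul]
    exact Finset.sum_congr rfl fun i _ => by ring
  rw [h1]
  ring

/-- **The charges sum to the degree weight**: over the finite set `F` of all roots of the `p_i`,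
`Σ_{ρ ∈ F} Σ_i w_i mult_ρ(p_i) = Σ_i w_i deg p_i` (every `p_i` splits over `ℂ`). -/
theorem sum_charges_eq [DecidableEq ℂ] (w : ι → ℝ) {p : ι → Polynomial ℂ} (hp : ∀ i, p i ≠ 0)
    (F : Finset ℂ) (hF : ∀ i, (p i).roots.toFinset ⊆ F) :
    ∑ ρ ∈ F, ∑ i, w i * (p i).rootMultiplicity ρ = ∑ i, w i * (p i).natDegree := by
  rw [Finset.sum_comm]
  refine Finset.sum_congr rfl fun i _ => ?_
  rw [← Finset.mul_sum]
  congr 1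
  have h1 : ∑ ρ ∈ F, ((p i).rootMultiplicity ρ : ℝ) =
      ∑ ρ ∈ (p i).roots.toFinset, ((p i).rootMultiplicity ρ : ℝ) := by
    refine (Finset.sum_subset (hF i) fun ρ _ hρ => ?_).symm
    rw [Multiset.mem_toFinset, Polynomial.mem_roots (hp i)] at hρ
    rw [Polynomial.rootMultiplicity_eq_zero hρ, Nat.cast_zero]
  rw [h1, (IsAlgClosed.splits (p i)).natDegree_eq_card_roots, ← Multiset.toFinset_sum_count_eq]
  push_cast
  refine Finset.sum_congr rfl fun ρ _ => ?_
  rw [Polynomial.count_roots]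

/-- The complement of the (finite) root set is preconnected in `ℂ`. -/
theorem isPreconnected_compl_roots {p : ι → Polynomial ℂ} (hp : ∀ i, p i ≠ 0) :
    IsPreconnected {u : ℂ | ∀ i, (p i).eval u ≠ 0} := by
  have hfin : {u : ℂ | ∃ i, (p i).IsRoot u}.Finite := by
    have : {u : ℂ | ∃ i, (p i).IsRoot u} = ⋃ i, {u : ℂ | (p i).IsRoot u} := by
      ext u; simp
    rw [this]
    exact Set.finite_iUnion fun i => Polynomial.finite_setOf_isRoot (hp i)
  have h1 : {u : ℂ | ∀ i, (p i).eval u ≠ 0} = {u : ℂ | ∃ i, (p i).IsRoot u}ᶜ := by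
    ext u
    simp [Polynomial.IsRoot]
  rw [h1]
  have hrank : 1 < Module.rank ℝ ℂ := by
    rw [Complex.rank_real_complex]
    norm_num
  exact (hfin.countable.isPathConnected_compl_of_one_lt_rank hrank).isConnected.isPreconnected

/-- **Zeros of weighted log-moduli.** For nonzero `p_i ∈ ℂ[u]` and real weights with
`Σ_i w_i deg p_i ≠ 0`, the function `Σ_i w_i log |p_i(u)| + C` vanishes at some `u` off the roots
of the `p_i` (charges + connectedness; see the module docstring). -/
theorem exists_zero_weightedLogNorm (w : ι → ℝ) (C : ℝ) {p : ι → Polynomial ℂ}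
    (hp : ∀ i, p i ≠ 0) (hdeg : ∑ i, w i * (p i).natDegree ≠ 0) :
    ∃ u : ℂ, (∀ i, (p i).eval u ≠ 0) ∧ ∑ i, w i * Real.log ‖(p i).eval u‖ + C = 0 := by
  classical
  set φ : ℂ → ℝ := fun v => ∑ i, w i * Real.log ‖(p i).eval v‖ + C with hφ
  set Ω : Set ℂ := {u : ℂ | ∀ i, (p i).eval u ≠ 0} with hΩ
  set S : ℝ := ∑ i, w i * (p i).natDegree with hS
  set F : Finset ℂ := Finset.univ.biUnion fun i => (p i).roots.toFinset with hFdef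
  have hF : ∀ i, (p i).roots.toFinset ⊆ F := fun i =>
    Finset.subset_biUnion_of_mem (fun i => (p i).roots.toFinset) (Finset.mem_univ i)
  have hcharge := sum_charges_eq w hp F hF
  -- a point of each sign from the end at infinity
  obtain ⟨G₀, hG⟩ := tendsto_weightedLogNorm_sub_atTop w C hp
  have hΩtop : ∀ᶠ t : ℝ in atTop, ((t : ℂ)) ∈ Ω := by
    have h1 : ∀ i, ∀ᶠ t : ℝ in atTop, (p i).eval (t : ℂ) ≠ 0 := by
      intro i
      have hfin : {x : ℂ | (p i).IsRoot x}.Finite := Polynomial.finite_setOf_isRoot (hp i)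
      have h2 : ∀ᶠ t : ℝ in atTop, ∀ x ∈ {x : ℂ | (p i).IsRoot x}, ‖x‖ < t :=
        (hfin.eventually_all (l := atTop) (p := fun x t => ‖x‖ < t)).2
          fun x _ => eventually_gt_atTop ‖x‖
      filter_upwards [h2, eventually_gt_atTop (0 : ℝ)] with t ht ht0 h0
      have h3 := ht (t : ℂ) h0
      rw [norm_real, Real.norm_eq_abs, abs_of_pos ht0] at h3
      exact lt_irrefl _ h3
    filter_upwards [eventually_all.2 h1] with t ht
    exact ht
  have hdec : ∀ t : ℝ, φ (t : ℂ) = (φ (t : ℂ) - S * Real.log t) + S * Real.log t := fun t => by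
    ring
  -- a point of each sign near a charge
  have hcharge_pt : ∀ ρ ∈ F, (0 < ∑ i, w i * (p i).rootMultiplicity ρ →
      ∃ u ∈ Ω, φ u < 0) ∧ (∑ i, w i * (p i).rootMultiplicity ρ < 0 → ∃ u ∈ Ω, 0 < φ u) := by
    intro ρ _
    obtain ⟨G₁, hG₁⟩ := tendsto_weightedLogNorm_sub_charge w C hp ρ
    set e : ℝ := ∑ i, w i * (p i).rootMultiplicity ρ with he
    have hΩ0 : ∀ᶠ t : ℝ in 𝓝[>] 0, ρ + (t : ℂ) ∈ Ω := by
      have h1 : ∀ i, ∀ᶠ t : ℝ in 𝓝[>] 0, (p i).eval (ρ + t) ≠ 0 := by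
        intro i
        obtain ⟨g, hg, hndvd⟩ :=
          Polynomial.exists_eq_pow_rootMultiplicity_mul_and_not_dvd (p i) (hp i) ρ
        have hgρ : g.eval ρ ≠ 0 := fun h0 => hndvd (Polynomial.dvd_iff_isRoot.2 h0)
        have hgc : ContinuousAt (fun t : ℝ => g.eval (ρ + t)) 0 :=
          (g.continuous.comp (continuous_const.add continuous_ofReal)).continuousAt
        have h2 : Tendsto (fun t : ℝ => g.eval (ρ + t)) (𝓝[>] 0) (𝓝 (g.eval ρ)) := by
          have h3 := hgc.tendsto
          simp only [ofReal_zero, add_zero] at h3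
          exact h3.mono_left nhdsWithin_le_nhds
        filter_upwards [h2.eventually_ne hgρ, self_mem_nhdsWithin] with t hgt (ht : 0 < t)
        rw [hg]
        simp only [Polynomial.eval_mul, Polynomial.eval_pow, Polynomial.eval_sub,
          Polynomial.eval_X, Polynomial.eval_C, add_sub_cancel_left]
        exact mul_ne_zero (pow_ne_zero _ (by exact_mod_cast ht.ne')) hgt
      filter_upwards [eventually_all.2 h1] with t ht
      exact ht
    have hdec' : ∀ t : ℝ, φ (ρ + t) = (φ (ρ + t) - e * Real.log t) + e * Real.log t := fun t => by
      ring
    constructor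
    · intro hpos
      have hlim : Tendsto (fun t : ℝ => φ (ρ + t)) (𝓝[>] 0) atBot := by
        have h1 := hG₁.add_atBot (Real.tendsto_log_nhdsGT_zero.const_mul_atBot hpos)
        exact h1.congr' (Eventually.of_forall fun t => (hdec' t).symm)
      obtain ⟨t, ht, hΩt⟩ := ((hlim.eventually_lt_atBot 0).and hΩ0).exists
      exact ⟨_, hΩt, ht⟩
    · intro hneg
      have hlim : Tendsto (fun t : ℝ => φ (ρ + t)) (𝓝[>] 0) atTop := by
        have h1 := hG₁.add_atTop (Real.tendsto_log_nhdsGT_zero.const_mul_atBot_of_neg hneg)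
        exact h1.congr' (Eventually.of_forall fun t => (hdec' t).symm)
      obtain ⟨t, ht, hΩt⟩ := ((hlim.eventually_gt_atTop 0).and hΩ0).exists
      exact ⟨_, hΩt, ht⟩
  -- two points of opposite signs
  obtain ⟨uP, huP, uM, huM, hsign⟩ : ∃ uP ∈ Ω, ∃ uM ∈ Ω, φ uM < 0 ∧ 0 < φ uP := by
    rcases lt_or_gt_of_ne hdeg with hneg | hpos
    · -- `S < 0`: `-∞` at infinity, `+∞` at a negative charge
      have hlim : Tendsto (fun t : ℝ => φ (t : ℂ)) atTop atBot := by
        have h1 := hG.add_atBot (Real.tendsto_log_atTop.const_mul_atTop_of_neg hneg)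
        exact h1.congr' (Eventually.of_forall fun t => (hdec t).symm)
      obtain ⟨t, ht, hΩt⟩ := ((hlim.eventually_lt_atBot 0).and hΩtop).exists
      have hex : ∃ ρ ∈ F, ∑ i, w i * (p i).rootMultiplicity ρ < 0 := by
        by_contra hall
        push Not at hall
        have : 0 ≤ ∑ ρ ∈ F, ∑ i, w i * (p i).rootMultiplicity ρ := Finset.sum_nonneg hall
        rw [hcharge] at this
        linarith
      obtain ⟨ρ, hρF, hρ⟩ := hex
      obtain ⟨u, huΩ, hu⟩ := (hcharge_pt ρ hρF).2 hρ
      exact ⟨u, huΩ, (t : ℂ), hΩt, ht, hu⟩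
    · -- `S > 0`: `+∞` at infinity, `-∞` at a positive charge
      have hlim : Tendsto (fun t : ℝ => φ (t : ℂ)) atTop atTop := by
        have h1 := hG.add_atTop (Real.tendsto_log_atTop.const_mul_atTop hpos)
        exact h1.congr' (Eventually.of_forall fun t => (hdec t).symm)
      obtain ⟨t, ht, hΩt⟩ := ((hlim.eventually_gt_atTop 0).and hΩtop).exists
      have hex : ∃ ρ ∈ F, 0 < ∑ i, w i * (p i).rootMultiplicity ρ := by
        by_contra hall
        push Not at hall
        have : ∑ ρ ∈ F, ∑ i, w i * (p i).rootMultiplicity ρ ≤ 0 := Finset.sum_nonpos hall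
        rw [hcharge] at this
        linarith
      obtain ⟨ρ, hρF, hρ⟩ := hex
      obtain ⟨u, huΩ, hu⟩ := (hcharge_pt ρ hρF).1 hρ
      exact ⟨(t : ℂ), hΩt, u, huΩ, hu, ht⟩
  -- intermediate value theorem on the connected set `Ω`
  have hcont : ContinuousOn φ Ω := fun u hu =>
    (continuousAt_weightedLogNorm w C p hu).continuousWithinAt
  obtain ⟨u, huΩ, hu⟩ := (isPreconnected_compl_roots hp).intermediate_value huM huP hcont
    ⟨hsign.1.le, hsign.2.le⟩
  exact ⟨u, huΩ, hu⟩

end WeightedLogNorm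

/-! ## The level set of the split varieties -/

section SplitLevel

variable {s : ℕ}

/-- **Level point for the split varieties.** For real `r`, `c ∈ ℂ` and nonzero `qⱼ ∈ ℂ[u]`
(`j < s`) with `Σⱼ rⱼ deg qⱼ ≠ 1` there is `u₀ ≠ 0` with all `qⱼ(u₀) ≠ 0` on the level set
`log |u₀| = Σⱼ rⱼ log |qⱼ(u₀)| + Re c` — `exists_zero_weightedLogNorm` for the family
`(u, q₁, …, q_s)` with weights `(1, -r₁, …, -r_s)`. -/
theorem exists_splitLevelPoint (r : Fin s → ℝ) (c : ℂ) {q : Fin s → Polynomial ℂ}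
    (hq : ∀ j, q j ≠ 0) (hdeg : ∑ j, r j * (q j).natDegree ≠ 1) :
    ∃ u₀ : ℂ, u₀ ≠ 0 ∧ (∀ j, (q j).eval u₀ ≠ 0) ∧
      Real.log ‖u₀‖ = ∑ j, r j * Real.log ‖(q j).eval u₀‖ + c.re := by
  set p : Fin (s + 1) → Polynomial ℂ := Fin.cons Polynomial.X q with hp
  set w : Fin (s + 1) → ℝ := Fin.cons 1 (fun j => -r j) with hw
  have hp0 : ∀ i, p i ≠ 0 := by
    refine Fin.cases ?_ (fun j => ?_)
    · simp [hp, Polynomial.X_ne_zero]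
    · simpa [hp] using hq j
  have hdeg' : ∑ i, w i * (p i).natDegree ≠ 0 := by
    rw [Fin.sum_univ_succ]
    simp only [hw, hp, Fin.cons_zero, Fin.cons_succ, Polynomial.natDegree_X, Nat.cast_one,
      mul_one, neg_mul, Finset.sum_neg_distrib]
    intro h
    apply hdeg
    linarith
  obtain ⟨u, hu, hφ⟩ := exists_zero_weightedLogNorm w (-c.re) hp0 hdeg'
  refine ⟨u, ?_, fun j => ?_, ?_⟩
  · have := hu 0
    simpa [hp] using this
  · have := hu j.succ
    simpa [hp] using this
  · rw [Fin.sum_univ_succ] at hφ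
    simp only [hw, hp, Fin.cons_zero, Fin.cons_succ, Polynomial.eval_X, one_mul, neg_mul,
      Finset.sum_neg_distrib] at hφ
    linarith

end SplitLevel

end Summit.Schanuel.Schanuel.Theorems

end
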